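import Literature.AlgebraicGeometry.Resolution.QuasiExcellentLocalization
import Literature.AlgebraicGeometry.Resolution.QuasiExcellentSchemes
import Literature.AlgebraicGeometry.Resolution.RegularBlowup
import HarnessLib

/-!
# The J-2 property is local and passes to blowing ups (Matsumura §32; EGA IV 6.12)

Topic: `Literature/AlgebraicGeometry/Resolution`. The regular/singular loci of finite type
schemes over the schemes `X(i)` occurring in Cossart–Piltant's principalization ([CoP1]
Prop. 4.2, CP 2019 Prop. 4.4) are open/closed because these schemes are J-2: the base is
excellent and each `X(i+1) → X(i)` is a blowing up, hence of finite type. PROVED here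
(Matsumura, *Commutative Ring Theory*, §32, p. 260: "if `A` is J-2 then every finitely
generated `A`-algebra and every localization of `A` is J-2"; the Zariski-local nature of the
property):

* `isJ2Ring_of_span_eq_top` — **J-2 is local**: if `(s) = A` and the localizations `A_g`,
  `g ∈ s`, of the Noetherian ring `A` are J-2, then `A` is J-2 (for `C` of finite type over `A`,
  `Reg(C) ∩ D(g)` is the homeomorphic image of the open `Reg(C_g)`, `C_g` being of finite type
  over `A_g`);
* `isJ2Ring_sections_of_locallyOfFiniteType` — for `f : X → Y` locally of finite type with `X`
  locally Noetherian and all `Γ(Y, U)` (`U` affine) J-2, all `Γ(X, V)` (`V` affine) are J-2;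
* `Scheme.IsExcellent.isJ2Ring_sections`, `IsBlowup.isJ2Ring_sections`,
  `IsRegularCentreBlowupSeq.isLocallyNoetherian_and_isJ2Ring_sections`,
  `IsRegularCentreBlowupSeq.isJ2Ring_sections` — the affine coordinate rings of an excellent
  scheme, of a blowing up of a locally Noetherian scheme with J-2 coordinate rings, and of
  every stage of a Cossart–Piltant sequence over an excellent locally Noetherian scheme are J-2.

## Sources

* H. Matsumura, *Commutative Ring Theory*, CUP 1986, §32, p. 260 (J-0, J-1, J-2; stability of
  J-2 under finite type and localization). [cite: Matsumura1987, §32 p. 260]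
* A. Grothendieck, EGA IV₂, (6.12.4)–(6.12.8) — background.
-/

noncomputable section

open CategoryTheory CategoryTheory.Limits AlgebraicGeometry TopologicalSpace IsLocalRing

namespace Literature.AlgebraicGeometry.Resolution

universe u

/-! ## J-2 is a local property -/

/-- **J-2 is local on `Spec A`**: let `A` be Noetherian and `s ⊆ A` with `(s) = A`; if for each
`g ∈ s` some localization `A_g` is J-2, then `A` is J-2. For `C` of finite type over `A` and
`g ∈ s`, `C_g` is of finite type over `A_g`, so `Reg(C_g)` is open, and `Reg(C) ∩ D(g)` is its
image under the open embedding `Spec C_g → Spec C`; these cover `Reg(C)`.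
[cite: Matsumura1987, §32 p. 260] -/
theorem isJ2Ring_of_span_eq_top {A : Type u} [CommRing A] [IsNoetherianRing A] (s : Set A)
    (hs : Ideal.span s = ⊤) (T : s → Type u) [∀ g, CommRing (T g)] [∀ g, Algebra A (T g)]
    [∀ g : s, IsLocalization.Away (g : A) (T g)] (h : ∀ g, IsJ2Ring (T g)) : IsJ2Ring A := by
  refine ⟨inferInstance, fun C _ _ hC => ?_⟩
  -- every prime of `C` misses some `g ∈ s`
  have hcov : ∀ q : PrimeSpectrum C, ∃ g ∈ s, algebraMap A C g ∉ q.asIdeal := by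
    intro q
    by_contra hall
    push Not at hall
    have hle : (Ideal.span s).map (algebraMap A C) ≤ q.asIdeal := by
      rw [Ideal.map_span]
      exact Ideal.span_le.mpr (by rintro _ ⟨g, hg, rfl⟩; exact hall g hg)
    rw [hs, Ideal.map_top, top_le_iff] at hle
    exact q.isPrime.ne_top hle
  rw [isOpen_iff_forall_mem_open]
  intro q hq
  obtain ⟨g, hgs, hgq⟩ := hcov q
  -- `C_g`, of finite type over `A_g = T g`, is J-2-regular-open
  let Cg := Localization.Away (algebraMap A C g)
  have hft : (algebraMap A C).FiniteType := by
    rw [RingHom.finiteType_algebraMap]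
    exact hC
  haveI : IsLocalization.Away g (T ⟨g, hgs⟩) := ‹∀ g : s, IsLocalization.Away (g : A) (T g)› ⟨g, hgs⟩
  have hmap := RingHom.localization_away_map_finiteType A C (T ⟨g, hgs⟩) Cg (algebraMap A C) g hft
  letI algTC : Algebra (T ⟨g, hgs⟩) Cg :=
    (IsLocalization.Away.map (T ⟨g, hgs⟩) Cg (algebraMap A C) g).toAlgebra
  have hCg : Algebra.FiniteType (T ⟨g, hgs⟩) Cg := hmap
  have hopen : IsOpen (regularLocus Cg) := (h ⟨g, hgs⟩).2 Cg hCg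
  -- `Reg(C) ∩ D(g)` is the image of `Reg(C_g)` under the open embedding `Spec C_g → Spec C`
  have hemb := PrimeSpectrum.localization_away_isOpenEmbedding Cg (algebraMap A C g)
  refine ⟨PrimeSpectrum.comap (algebraMap C Cg) '' regularLocus Cg, ?_, hemb.isOpenMap _ hopen, ?_⟩
  · rintro _ ⟨p, hp, rfl⟩
    rwa [regularLocus_eq_preimage_comap_of_isLocalization (Submonoid.powers (algebraMap A C g))] at hp
  · have hqD : q ∈ Set.range (PrimeSpectrum.comap (algebraMap C Cg)) := by
      rw [PrimeSpectrum.localization_away_comap_range Cg (algebraMap A C g)]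
      exact hgq
    obtain ⟨p, rfl⟩ := hqD
    refine ⟨p, ?_, rfl⟩
    rwa [regularLocus_eq_preimage_comap_of_isLocalization (Submonoid.powers (algebraMap A C g))]

/-! ## J-2 coordinate rings under morphisms locally of finite type -/

/-- **Schemes locally of finite type over a "J-2 scheme" are J-2**: if `f : X → Y` is locally
of finite type, `X` is locally Noetherian and `Γ(Y, U)` is J-2 for every affine open `U ⊆ Y`,
then `Γ(X, V)` is J-2 for every affine open `V ⊆ X`. Indeed `V` is covered by basic opens
`D(g)` lying over affine opens `U` of `Y`, with `Γ(X, D(g)) = Γ(X, V)_g` of finite type over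
`Γ(Y, U)`, hence J-2; conclude by `isJ2Ring_of_span_eq_top`. [cite: Matsumura1987, §32 p. 260] -/
theorem isJ2Ring_sections_of_locallyOfFiniteType {X Y : Scheme.{u}} (f : X ⟶ Y)
    [LocallyOfFiniteType f] [IsLocallyNoetherian X]
    (hY : ∀ U : Y.affineOpens, IsJ2Ring Γ(Y, U)) (V : X.affineOpens) : IsJ2Ring Γ(X, V) := by
  haveI : IsNoetherianRing Γ(X, V) := IsLocallyNoetherian.component_noetherian V
  -- the sections `g` whose basic open lies over an affine open of `Y`
  let s : Set Γ(X, V) := {g | ∃ U : Y.affineOpens, X.basicOpen g ≤ f ⁻¹ᵁ (U : Y.Opens)}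
  have hs : Ideal.span s = ⊤ := by
    rw [← V.2.self_le_iSup_basicOpen_iff]
    intro x hxV
    obtain ⟨U, hU, hxU, -⟩ := exists_isAffineOpen_mem_and_subset (X := Y) (x := f x)
      (U := ⊤) (Opens.mem_top _)
    obtain ⟨g, hgle, hxg⟩ := V.2.exists_basicOpen_le (V := f ⁻¹ᵁ U) ⟨x, hxU⟩ hxV
    exact Opens.mem_iSup.mpr ⟨⟨g, ⟨U, hU⟩, hgle⟩, hxg⟩
  haveI : ∀ g : s, IsLocalization.Away (g : Γ(X, V)) Γ(X, X.basicOpen (g : Γ(X, V))) :=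
    fun g => V.2.isLocalization_basicOpen (g : Γ(X, V))
  refine isJ2Ring_of_span_eq_top s hs (fun g => Γ(X, X.basicOpen (g : Γ(X, V)))) fun g => ?_
  obtain ⟨U, hU⟩ := g.2
  -- `Γ(X, D(g))` is of finite type over `Γ(Y, U)`
  have hft : (f.appLE U (X.basicOpen (g : Γ(X, V))) hU).hom.FiniteType :=
    HasRingHomProperty.appLE (P := @LocallyOfFiniteType) (f := f) inferInstance U
      ⟨_, V.2.basicOpen (g : Γ(X, V))⟩ hU
  letI := (f.appLE U (X.basicOpen (g : Γ(X, V))) hU).hom.toAlgebra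
  exact (hY U).of_finiteType hft

/-! ## Excellent schemes, blowing ups, Cossart–Piltant sequences -/

/-- The affine coordinate rings of an excellent scheme are J-2. [cite: Matsumura1987, §32 p. 260] -/
theorem Scheme.IsExcellent.isJ2Ring_sections {X : Scheme.{u}} (hE : Scheme.IsExcellent X)
    (U : X.affineOpens) : IsJ2Ring Γ(X, U) :=
  ((hE U).isQuasiExcellentRing).isJ2Ring

/-- **A blowing up of a Noetherian "J-2 scheme" is a "J-2 scheme"** (a blowing up is proper,
hence locally of finite type). [cite: Matsumura1987, §32 p. 260] -/
theorem IsBlowup.isJ2Ring_sections {X' X : Scheme.{u}} {π : X' ⟶ X} {C : X.IdealSheafData}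
    [IsLocallyNoetherian X] (hπ : IsBlowup π C) (hX : ∀ U : X.affineOpens, IsJ2Ring Γ(X, U))
    (V : X'.affineOpens) : IsJ2Ring Γ(X', V) := by
  haveI : IsProper π := hπ.isProper
  haveI : IsLocallyNoetherian X' := LocallyOfFiniteType.isLocallyNoetherian π
  exact isJ2Ring_sections_of_locallyOfFiniteType π hX V

/-- **Every stage of a Cossart–Piltant sequence over a locally Noetherian scheme with J-2
affine coordinate rings (e.g. an excellent one) is locally Noetherian with J-2 affine
coordinate rings.** [cite: Matsumura1987, §32 p. 260] -/
theorem IsRegularCentreBlowupSeq.isLocallyNoetherian_and_isJ2Ring_sections :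
    ∀ {S' S : Scheme.{u}} {σ : S' ⟶ S} {J : S.IdealSheafData}, IsRegularCentreBlowupSeq σ J →
      IsLocallyNoetherian S → (∀ U : S.affineOpens, IsJ2Ring Γ(S, U)) →
      IsLocallyNoetherian S' ∧ ∀ V : S'.affineOpens, IsJ2Ring Γ(S', V) := by
  intro S' S σ J h
  induction h with
  | nil J => exact fun hN hS => ⟨hN, hS⟩
  | cons τ σ J Y hσ hint hreg hY hτ ih =>
    intro hN hS
    obtain ⟨hN', hS'⟩ := ih hN hS
    haveI := hN'
    haveI : IsProper τ := hτ.isProper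
    exact ⟨LocallyOfFiniteType.isLocallyNoetherian τ, hτ.isJ2Ring_sections hS'⟩

/-- In particular over an excellent locally Noetherian scheme. [cite: Matsumura1987, §32 p. 260] -/
theorem IsRegularCentreBlowupSeq.isJ2Ring_sections {S' S : Scheme.{u}} {σ : S' ⟶ S}
    {J : S.IdealSheafData} (h : IsRegularCentreBlowupSeq σ J) [IsLocallyNoetherian S]
    (hE : Scheme.IsExcellent S) (V : S'.affineOpens) : IsJ2Ring Γ(S', V) :=
  (h.isLocallyNoetherian_and_isJ2Ring_sections inferInstance hE.isJ2Ring_sections).2 V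

end Literature.AlgebraicGeometry.Resolution

end
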